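import Literature.Barriers.PneNP.LocalityCircuit
import HarnessLib

/-!
# The kernelization circuit for `(n-k)`-Clique: semantics and assembly

Continuation of `LocalityCircuit.lean` (Chen–Hirahara–Oliveira–Pich–Rajgopal–Santhanam,
Prop. 50 (E1^𝒪) [arXiv191108297]): the four layers compute the intended values
(`layer1_val` … `layer4_val`, using Buss' kernel API of
`Literature.Combinatorics.SimpleGraph.VertexCoverKernel`), and composing them with sharing
(`ACVec.comp`) on top of the `n choose 2` negation gates gives ONE multi-output circuit over
`acBasis` of depth `6r + 10` and size `kernelSize n k b r` computing the kernel bits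
(`acVec_kernelBits`). Everything here is proved; the discharge `Locality_holds` is in
`LocalityE1Proofs.lean`.

## References

* [arXiv191108297] L. Chen et al., *Beyond natural proofs: hardness magnification and
  locality*, Prop. 50 and its proof (p. 27); Appendix A, Prop. 63 (p. 37).
-/

noncomputable section

open Classical Finset
open Literature.Computability.Complexity Literature.Combinatorics.SimpleGraph

namespace Literature.Barriers.PneNP.Locality

variable {n : ℕ}

/-! ### Semantics of the layers -/

variable {k : ℕ} {x : (⊤ : SimpleGraph (Fin n)).edgeSet → Bool}

/-- Layer 1 on the negated literals computes `val1`. [folklore] -/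
theorem layer1_val (κ : K1 n) :
    (match κ with
      | .inl v => decide (k + 1 ≤ (univ.filter fun u : {u // u ≠ v} =>
          (fun e => !x e) (edge u.1 v u.2) = true).card)
      | .inr e => (fun e => !x e) e) = val1 k x κ := by
  cases κ with
  | inr e => rfl
  | inl v =>
    simp only [val1, mem_high, card_nonNbrs_eq, Bool.not_eq_true', decide_eq_decide]
    rw [show (univ.filter fun u : {u // u ≠ v} => x (edge u.1 v u.2) = false) =
        univ.filter fun u : {u // u ≠ v} => ¬ (cliqueGraph x).Adj u.1 v from
      filter_congr fun u _ => by rw [cliqueGraph_adj_edge u.2]; simp]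

/-- Layer 2 on `val1` computes `val2`. [folklore] -/
theorem layer2_val (κ : K2 n k) :
    (match κ with
      | .inl i => decide (i.1 + 1 ≤ (univ.filter fun v : Fin n => val1 k x (.inl v) = true).card)
      | .inr (.inl v) => !val1 k x (.inl v) &&
          decide (∃ u : {u // u ≠ v},
            (!val1 k x (.inl u.1) && val1 k x (.inr (edge u.1 v u.2))) = true)
      | .inr (.inr e) => val1 k x (.inr e)) = val2 k x κ := by
  rcases κ with i | v | e
  · simp [val1, val2]
  · show (!val1 k x (.inl v) && decide (∃ u : {u // u ≠ v},
        (!val1 k x (.inl u.1) && val1 k x (.inr (edge u.1 v u.2))) = true)) =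
      decide (v ∈ ker (cliqueGraph x) k)
    rw [Bool.eq_iff_iff]
    simp only [val1, Bool.and_eq_true, Bool.not_eq_true', decide_eq_false_iff_not,
      decide_eq_true_eq, mem_ker]
    constructor
    · rintro ⟨hv, u, hu, hux⟩
      refine ⟨hv, u.1, u.2, hu, fun h => ?_⟩
      rw [cliqueGraph_adj_edge u.2] at h
      rw [h] at hux
      exact Bool.noConfusion hux
    · rintro ⟨hv, u, huv, hu, hadj⟩
      refine ⟨hv, ⟨u, huv⟩, hu, ?_⟩
      rw [cliqueGraph_adj_edge huv, Bool.not_eq_true] at hadj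
      exact hadj
  · rfl

/-- Layer 3 on `val2` computes `val3`. [folklore] -/
theorem layer3_val (κ : K3 n k) :
    (match κ with
      | .inl _ => decide (2 * k ^ 2 + 1 ≤
          (univ.filter fun v : Fin n => val2 k x (.inr (.inl v)) = true).card)
      | .inr (.inl p) => decide (p.2.1 ≤
          (univ.filter fun u : {u // u < p.1} => val2 k x (.inr (.inl u.1)) = true).card)
      | .inr (.inr κ') => val2 k x κ') = val3 k x κ := by
  rcases κ with u | p | κ'
  · simp [val2, val3]
  · simp [val2, val3, rank_eq_card_subtype]
  · rfl

/-- The witness conjunction on `val3` says: `u, v ∈ ker`, `rank u = i`, `rank v = j`, `¬ Adj u v`.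
[folklore] -/
theorem adjLits_val3 (i j : Fin (2 * k ^ 2 + 1)) (p : {p : Fin n × Fin n // p.1 ≠ p.2}) :
    adjLits k i j p (val3 k x) = true ↔
      p.1.1 ∈ ker (cliqueGraph x) k ∧ p.1.2 ∈ ker (cliqueGraph x) k ∧
        rank (cliqueGraph x) k p.1.1 = i ∧ rank (cliqueGraph x) k p.1.2 = j ∧
          ¬ (cliqueGraph x).Adj p.1.1 p.1.2 := by
  simp only [adjLits, val3, val2, Bool.and_eq_true, decide_eq_true_eq, Bool.not_eq_true',
    decide_eq_false_iff_not, rank_eq_iff (i := (i : ℕ)), rank_eq_iff (i := (j : ℕ)),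
    cliqueGraph_adj_edge p.2, Bool.not_eq_true]
  tauto

/-- Layer 4 on `val3` computes the kernel bits. [folklore] -/
theorem layer4_val (κ : KB k) :
    (match κ with
      | .inl i => val3 k x (.inr (.inr (.inl i)))
      | .inr (.inl _) => val3 k x (.inl ())
      | .inr (.inr q) => decide (∃ p : {p : Fin n × Fin n // p.1 ≠ p.2},
          adjLits k q.1 q.2 p (val3 k x) = true)) = kernelBits k x κ := by
  rcases κ with i | u | q
  · rfl
  · rfl
  · simp only [kernelBits, kerAdj, adjLits_val3, decide_eq_decide]
    constructor
    · rintro ⟨p, hu, hv, hi, hj, hadj⟩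
      exact ⟨p.1.1, p.1.2, hu, hv, hi, hj, p.2, hadj⟩
    · rintro ⟨u, v, hu, hv, hi, hj, huv, hadj⟩
      exact ⟨⟨(u, v), huv⟩, hu, hv, hi, hj, hadj⟩

/-! ### The kernel circuit -/

/-- **The kernelization circuit.** For tree parameters with `2(2k²+1)² < b^r` (`r ≥ 1`), the
kernel bits are computed by ONE multi-output circuit over `acBasis` of depth `6r + 10` and size
`kernelSize n k b r` (the four layers composed with sharing on top of the `n choose 2` negation
gates). [cite: arXiv191108297, Prop. 50] -/
theorem acVec_kernelBits (k b r : ℕ) (hbr : 2 * (2 * k ^ 2 + 1) ^ 2 < b ^ r) (hr : 1 ≤ r) :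
    ACVec (ι := (⊤ : SimpleGraph (Fin n)).edgeSet) (kernelBits k) (6 * r + 10)
      (kernelSize n k b r) := by
  -- layer 0: the negated literals
  have h0 : ACVec (ι := (⊤ : SimpleGraph (Fin n)).edgeSet) (fun x e => !x e) 0 (n ^ 2) := by
    have h := acVec_ofBlocks_fintype (ι := (⊤ : SimpleGraph (Fin n)).edgeSet)
      (f := fun e x => !x e) (s := fun _ => 1) fun e => acReal_notInput e
    refine h.mono le_rfl ?_
    rw [sum_const, smul_eq_mul, mul_one, card_univ]
    calc Fintype.card ((⊤ : SimpleGraph (Fin n)).edgeSet)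
        = (⊤ : SimpleGraph (Fin n)).edgeFinset.card := by rw [SimpleGraph.edgeFinset_card]
      _ = n.choose 2 := by rw [SimpleGraph.card_edgeFinset_top_eq_card_choose_two, Fintype.card_fin]
      _ ≤ n ^ 2 := by
        rw [Nat.choose_two_right, sq]
        exact (Nat.div_le_self _ _).trans (Nat.mul_le_mul_left _ (Nat.sub_le _ _))
  have h1 := (acVec_layer1 (n := n) k b r hbr).comp h0
  have h1' : ACVec (val1 (n := n) k) (2 * r + 2) (n * gadgetSize n k b r + n ^ 2) :=
    (h1.congr fun x κ => layer1_val κ).mono (by omega) le_rfl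
  have h2 := ((acVec_layer2 (n := n) k b r hbr hr).comp h1').congr fun x κ => layer2_val κ
  have h3 := ((acVec_layer3 (n := n) k b r hbr).comp h2).congr fun x κ => layer3_val κ
  have h4 := ((acVec_layer4 (n := n) k).comp h3).congr fun x κ => layer4_val κ
  refine h4.mono (by omega) (le_of_eq ?_)
  unfold kernelSize
  ring

end Literature.Barriers.PneNP.Locality

end
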